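import Literature.MathematicalPhysics.QuantumManyBody.BoseGasFreeDirichletBEC
import HarnessLib

/-!
# Gap-scale windows DO certify `λ_max ≥ cN` in the Dirichlet box (free gas) — the cat-state obstruction is sharp

`Literature/Barriers/AtomisticToContinuum` — companion of `KineticGapLengthScalesModeFree.lean`
(cat states: a mode-free energy-window criterion whose window contains `C_cat m²` kinetic gaps per
particle certifies at most `λ_max/N ≤ 1/m³`) and of `KineticGapLengthScalesFreeGas.lean` (torus,
constant mode), filed by the crux disprover of `PeriodicToDirichlet` (stmt-AtomisticToContinuum-9483,
gen 2), from the key inequality of `BoseGasFreeDirichletBEC.lean`: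

* `dirichlet_gapWindow_fraction_ge` — CONVERSELY, for every `k ≥ 1`, every Dirichlet state of
  `Λ_L` (free gas, any `N ≥ 1`, any `L > 0`) with energy `≤ π²k² N/(2L²)` has
  `λ_max(γ_Ψ) ≥ N/(2k³)`: a window of `k²/2` gaps `π²/L²` per particle still certifies the
  fraction `1/(2k³)`;
* `free_dirichlet_gapWindow_condensation` — packaged relative to the ground state: `∃ κ, c > 0`
  with "`energy ≤ E₀^D + κN/L² ⇒ λ_max ≥ cN`" uniformly in `N` and `L` (the mode-free Dirichlet
  counterpart of `free_gas_gapWindow_condensation`).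

So on the Dirichlet side the certifiable fraction at a window of `∼ s` gaps per particle is
`Θ(s^{-3/2})` from both sides (`≥ (2k³)⁻¹` at `s = k²/2` here; `≤ m⁻³` at `s = C_cat m²/π²` by cat
states): the mode-free window obstruction is sharp in its exponent, and the admissible window for
an energy-only proof of `λ_max ≥ cN` is EXACTLY the order of one kinetic gap per particle — for the
free gas the order of the Dirichlet wall itself. Theorems only; `[folklore]` / LSSY Ch. 5.

## References

* [LSSY2005] E. H. Lieb, R. Seiringer, J. P. Solovej, J. Yngvason, *The Mathematics of the Bose Gas
  and its Condensation* (2005), Ch. 5 (5.15)–(5.17).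
-/

noncomputable section

namespace Literature.Barriers.AtomisticToContinuum.BoseGas

open Literature.MathematicalPhysics.QuantumManyBody.BoseGas
open _root_.MeasureTheory _root_.Filter _root_.Topology
open scoped ENNReal NNReal

variable {n k : ℕ} {L : ℝ}

/-- **Gap-scale windows certify a condensate fraction, cubically in the window** (Dirichlet box,
free gas): if `energy Ψ ≤ π²k²N/(2L²)` then `λ_max(γ_Ψ) ≥ N/(2k³)` (`N = n + 1`, `k ≥ 1`,
`L > 0`). [cite: LSSY2005, Ch. 5 (5.15)–(5.17)] -/
theorem dirichlet_gapWindow_fraction_ge (hk : 1 ≤ k) (hL : 0 < L) (Ψ : TrialState (n + 1) L)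
    (hE : energy 0 Ψ ≤ ENNReal.ofReal (Real.pi ^ 2 * k ^ 2 * (n + 1) / (2 * L ^ 2))) :
    ENNReal.ofReal ((n + 1) / (2 * (k : ℝ) ^ 3)) ≤ maxOccupation (n + 1) Ψ.ψ := by
  have hk0 : 0 < (k : ℝ) := by exact_mod_cast hk
  set ℓ : ℝ := L / k with hℓ
  have hℓ0 : 0 < ℓ := by positivity
  have hkℓ : (k : ℝ) * ℓ = L := by rw [hℓ]; field_simp
  set Cq : ℝ := (Real.pi / ℓ) ^ 2 with hCq
  have hCq0 : 0 < Cq := by positivity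
  have hCqL : Real.pi ^ 2 * k ^ 2 * (n + 1) / (2 * L ^ 2) = Cq * ((n + 1) / 2) := by
    rw [hCq, hℓ]; field_simp
  rw [hCqL] at hE
  have hkey := key_inequality (k := k) hℓ0 hkℓ Ψ
  have hsum : ENNReal.ofReal Cq * (n + 1 : ℝ≥0∞) ≤
      ENNReal.ofReal (Cq * ((n + 1) / 2)) +
        ENNReal.ofReal Cq * ∑ q : SubIdx k, occupation (n + 1) (subMode ℓ q) Ψ.ψ :=
    hkey.trans (add_le_add hE le_rfl)
  have hhalf : ENNReal.ofReal Cq * (n + 1 : ℝ≥0∞) =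
      ENNReal.ofReal (Cq * ((n + 1) / 2)) + ENNReal.ofReal (Cq * ((n + 1) / 2)) := by
    have hn1 : (n + 1 : ℝ≥0∞) = ENNReal.ofReal (n + 1) := by
      rw [ENNReal.ofReal_add (Nat.cast_nonneg _) zero_le_one, ENNReal.ofReal_natCast,
        ENNReal.ofReal_one]
    rw [← ENNReal.ofReal_add (by positivity) (by positivity), hn1,
      ← ENNReal.ofReal_mul (by positivity)]
    congr 1; ring
  rw [hhalf] at hsum
  have hocc : ENNReal.ofReal (Cq * ((n + 1) / 2)) ≤
      ENNReal.ofReal Cq * ∑ q : SubIdx k, occupation (n + 1) (subMode ℓ q) Ψ.ψ :=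
    (ENNReal.add_le_add_iff_left ENNReal.ofReal_ne_top).1 hsum
  rw [ENNReal.ofReal_mul hCq0.le] at hocc
  have hocc' : ENNReal.ofReal ((n + 1) / 2) ≤ ∑ q : SubIdx k, occupation (n + 1) (subMode ℓ q) Ψ.ψ :=
    (ENNReal.mul_le_mul_iff_right (by rwa [ne_eq, ENNReal.ofReal_eq_zero, not_le])
      ENNReal.ofReal_ne_top).1 hocc
  haveI : Nonempty (SubIdx k) := ⟨fun _ => ⟨0, hk⟩⟩
  obtain ⟨q, hq⟩ := exists_sum_le_card_mul fun q : SubIdx k => occupation (n + 1) (subMode ℓ q) Ψ.ψ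
  have hcard : (Fintype.card (SubIdx k) : ℝ≥0∞) = ENNReal.ofReal ((k : ℝ) ^ 3) := by
    rw [show Fintype.card (SubIdx k) = k ^ 3 by simp, ← ENNReal.ofReal_natCast]
    push_cast; rfl
  have hfin : ENNReal.ofReal ((n + 1) / 2) ≤
      ENNReal.ofReal ((k : ℝ) ^ 3) * occupation (n + 1) (subMode ℓ q) Ψ.ψ := by
    rw [← hcard]; exact hocc'.trans hq
  have hk3 : (0 : ℝ) < (k : ℝ) ^ 3 := by positivity
  calc ENNReal.ofReal ((n + 1) / (2 * (k : ℝ) ^ 3))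
      = (ENNReal.ofReal ((k : ℝ) ^ 3))⁻¹ * ENNReal.ofReal ((n + 1) / 2) := by
        rw [← ENNReal.ofReal_inv_of_pos hk3, ← ENNReal.ofReal_mul (by positivity)]
        congr 1; field_simp
    _ ≤ (ENNReal.ofReal ((k : ℝ) ^ 3))⁻¹ *
          (ENNReal.ofReal ((k : ℝ) ^ 3) * occupation (n + 1) (subMode ℓ q) Ψ.ψ) := by gcongr
    _ = occupation (n + 1) (subMode ℓ q) Ψ.ψ := by
        rw [← mul_assoc, ENNReal.inv_mul_cancel (by rwa [ne_eq, ENNReal.ofReal_eq_zero, not_le])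
          ENNReal.ofReal_ne_top, one_mul]
    _ ≤ maxOccupation (n + 1) Ψ.ψ :=
        occupation_le_maxOccupation Ψ.ψ (aestronglyMeasurable_subMode ℓ q) (lintegral_subMode_sq hℓ0 q)

/-- **The free Dirichlet gas condenses in a gap-scale window above its ground-state energy**,
uniformly in `N` and `L`: there are `κ, c > 0` such that every Dirichlet state of `Λ_L` with
`energy ≤ E₀^D(0, N, L) + κN/L²` has `λ_max ≥ cN` (`k` sub-cells per axis with
`k²π²/4 ≥ 𝓔₀[β] ≥ E₀^D L²/N`, `κ = π²k²/4`, `c = 1/(2k³)`). The mode-free Dirichlet counterpart of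
`free_gas_gapWindow_condensation` (torus, `n₀`). [cite: LSSY2005, Ch. 5 (5.15)–(5.17)] -/
theorem free_dirichlet_gapWindow_condensation :
    ∃ κ c : ℝ, 0 < κ ∧ 0 < c ∧ ∀ (n : ℕ) (L : ℝ), 0 < L → ∀ Ψ : TrialState (n + 1) L,
      energy 0 Ψ ≤ groundStateEnergy 0 (n + 1) L + ENNReal.ofReal (κ * (n + 1) / L ^ 2) →
        ENNReal.ofReal (c * (n + 1)) ≤ maxOccupation (n + 1) Ψ.ψ := by
  set E₁ : ℝ := (energy 0 unitBump).toReal with hE₁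
  have hE₁0 : 0 ≤ E₁ := ENNReal.toReal_nonneg
  have hEeq : energy 0 unitBump = ENNReal.ofReal E₁ := energy_unitBump_eq_ofReal
  set k : ℕ := ⌈E₁⌉₊ + 1 with hk
  have hk1 : 1 ≤ k := by omega
  have hkE : E₁ ≤ Real.pi ^ 2 * k ^ 2 / 4 := by
    have h1 : E₁ ≤ (k : ℝ) := by
      have := Nat.le_ceil E₁
      rw [hk]; push_cast; linarith
    have h2 : (k : ℝ) ≤ (k : ℝ) ^ 2 := by
      have : (1 : ℝ) ≤ k := by exact_mod_cast hk1
      nlinarith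
    have hπ : (9 : ℝ) < Real.pi ^ 2 := by nlinarith [Real.pi_gt_three]
    nlinarith
  refine ⟨Real.pi ^ 2 * k ^ 2 / 4, 1 / (2 * (k : ℝ) ^ 3), by positivity, by positivity,
    fun n L hL Ψ hΨ => ?_⟩
  have h := dirichlet_gapWindow_fraction_ge hk1 hL Ψ ?_
  · convert h using 2; ring
  -- the window: `E₀ + κN/L² ≤ π²k²N/(2L²)`
  refine hΨ.trans ?_
  have hE0 := groundStateEnergy_zero_le hL (n + 1)
  rw [hEeq, show ((n + 1 : ℕ) : ℝ≥0∞) = ENNReal.ofReal (n + 1) by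
      rw [← ENNReal.ofReal_natCast]; push_cast; rfl,
    ← ENNReal.ofReal_mul (by positivity), ← ENNReal.ofReal_mul (by positivity)] at hE0
  calc groundStateEnergy 0 (n + 1) L + ENNReal.ofReal (Real.pi ^ 2 * k ^ 2 / 4 * (n + 1) / L ^ 2)
      ≤ ENNReal.ofReal ((L ^ 2)⁻¹ * ((n + 1) * E₁)) +
          ENNReal.ofReal (Real.pi ^ 2 * k ^ 2 / 4 * (n + 1) / L ^ 2) := add_le_add hE0 le_rfl
    _ = ENNReal.ofReal ((L ^ 2)⁻¹ * ((n + 1) * E₁) + Real.pi ^ 2 * k ^ 2 / 4 * (n + 1) / L ^ 2) :=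
        (ENNReal.ofReal_add (by positivity) (by positivity)).symm
    _ ≤ ENNReal.ofReal (Real.pi ^ 2 * k ^ 2 * (n + 1) / (2 * L ^ 2)) := by
        refine ENNReal.ofReal_le_ofReal ?_
        have hL2 : 0 < L ^ 2 := by positivity
        have hn : (0 : ℝ) ≤ n + 1 := by positivity
        rw [show (L ^ 2)⁻¹ * ((n + 1) * E₁) + Real.pi ^ 2 * k ^ 2 / 4 * (n + 1) / L ^ 2 =
            (E₁ + Real.pi ^ 2 * k ^ 2 / 4) * (n + 1) / L ^ 2 by field_simp,
          div_le_div_iff₀ hL2 (by positivity)]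
        have : (E₁ + Real.pi ^ 2 * ↑k ^ 2 / 4) * 2 ≤ Real.pi ^ 2 * ↑k ^ 2 := by linarith
        calc (E₁ + Real.pi ^ 2 * ↑k ^ 2 / 4) * (↑n + 1) * (2 * L ^ 2)
            = ((E₁ + Real.pi ^ 2 * ↑k ^ 2 / 4) * 2) * ((↑n + 1) * L ^ 2) := by ring
          _ ≤ (Real.pi ^ 2 * ↑k ^ 2) * ((↑n + 1) * L ^ 2) := by gcongr
          _ = Real.pi ^ 2 * ↑k ^ 2 * (↑n + 1) * L ^ 2 := by ring

end Literature.Barriers.AtomisticToContinuum.BoseGas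

end
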